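import Literature.IUT.HodgeArakelov.MonoThetaProjectiveProp16CoreRef
import HarnessLib

/-!
# [IUTchII] Prop. 1.6 (i), successor predicate `RefIsCore`: consequences (proof-only companion)

PROOF-ONLY companion (theorems only; no `def`, no new named fact) of `MonoThetaProjectiveProp16CoreRef.lean` (abc-iut
cell, wave-5 seat abc-iut-w5-d030 gen 9; DAG node **IUTchII:Prop1.6(i)**, layer L6, outside the [IUTchIII] Cor. 3.12
cone). S. Mochizuki, *Inter-universal Teichmüller Theory II*, kurims manuscript (Dec. 2020), §1, Prop. 1.6 (i) p. 31
l. 16–33 ("`Π ↦ {(Π ⊆) Π_C(Π) ↠ Π/Δ}` … when `Π = Π^tp_{X̲̲_k}`, the inclusion `Π ⊆ Π_C(Π)` may be naturally identified with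
the inclusion `Π^tp_{X̲̲_k} ⊆ Π^tp_{C_k}`") [claim: Mochizuki2012, status: disputed] (IUTchII §1 Prop 1.6 (i), kurims p.31);
[AbsTopII] Cor. 3.3 (i) p. 68, Rmk. 3.3.3 p. 69 [cite: MochizukiAbsTopII2013, Cor 3.3 (i) p.68]; [SemiAnbd] §6
[cite: MochizukiSemiAnbd2006, §6 pp.69-74].

What is proved, under `Cd.RefIsCore X C eX eC`: `continuous_refIncl`, `refIncl_injective`, `isOpen_range_refIncl`
(`Π^tp_{X̲̲_k}` sits in `Π^tp_{C_k}` as an open subgroup), `inclRef_injective` (hence the frozen output's `inclRef` itself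
is injective), `exists_core_record` (an [AbsTopII] Cor. 3.3 record whose core completes the inclusion), and for the
bundled `CoreData.Genuine`: `Genuine.inclRef_injective`. (Clause (R0) at the [EtTh] model with `eX := refl` is
`ThetaSetting.deltaTemp_map_refl_ofDoubleUnderline`, p439497 — the same lemma serves (i) and (ii).) Nothing is inhabited
here; nothing takes a side on [IUTchIII] Cor. 3.12; typed ≠ proved for the series.
-/

open Topology

universe u

namespace Literature.IUT.HodgeArakelov

open Literature.AnabelianGeometry.SemiGraphs (TemperedCurve)
open Literature.AnabelianGeometry.AbsoluteAnabelian (FundamentalExtension)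

namespace CoreData

variable {S : ThetaSetting.{u}} {P : TopGroup.{u}} {p : ℕ} [Fact p.Prime] {Cd : CoreData S P}
  {X C : TemperedCurve p} {eX : X.PiTemp ≃ₜ* S.PiX} {eC : C.PiTemp ≃ₜ* Cd.PiCRef}

namespace RefIsCore

/-- Under the predicate the inclusion `Π^tp_X → Π^tp_C` is continuous.
[claim: Mochizuki2012, status: disputed] (IUTchII §1 Prop 1.6 (i), kurims p.31) -/
theorem continuous_refIncl (h : Cd.RefIsCore X C eX eC) : Continuous (Cd.refIncl X C eX eC) :=
  h.isOpenEmbedding_refIncl.continuous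

/-- Under the predicate the inclusion `Π^tp_X → Π^tp_C` is injective ("`Π ⊆ Π_C(Π)`").
[claim: Mochizuki2012, status: disputed] (IUTchII §1 Prop 1.6 (i), kurims p.31) -/
theorem refIncl_injective (h : Cd.RefIsCore X C eX eC) : Function.Injective (Cd.refIncl X C eX eC) :=
  h.isOpenEmbedding_refIncl.injective

/-- Under the predicate `Π^tp_{X̲̲_k}` is an OPEN subgroup of `Π^tp_{C_k}` (a finite étale covering `X̲̲_k → C_k`).
[cite: MochizukiSemiAnbd2006, §6 p.73] -/
theorem isOpen_range_refIncl (h : Cd.RefIsCore X C eX eC) : IsOpen (Set.range (Cd.refIncl X C eX eC)) :=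
  h.isOpenEmbedding_refIncl.isOpen_range

/-- Under the predicate the frozen output's reference inclusion `inclRef : Π^tp_{X̲̲_k} → Π^tp_{C_k}` is itself
injective (it differs from `refIncl` by isomorphisms). [claim: Mochizuki2012, status: disputed] (IUTchII §1 Prop 1.6 (i), kurims p.31) -/
theorem inclRef_injective (h : Cd.RefIsCore X C eX eC) : Function.Injective Cd.inclRef := by
  intro a b hab
  have key : Cd.refIncl X C eX eC (eX.symm a) = Cd.refIncl X C eX eC (eX.symm b) := by
    rw [refIncl_apply, refIncl_apply, ContinuousMulEquiv.apply_symm_apply, ContinuousMulEquiv.apply_symm_apply, hab]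
  simpa using congrArg eX (h.refIncl_injective key)

/-- Under the predicate there is an [AbsTopII] Cor. 3.3 record whose CORE `Π' ↪ Π_C` is the completion of
`Π^tp_{X̲̲_k} ⊆ Π^tp_{C_k}`. [cite: MochizukiAbsTopII2013, Cor 3.3 (i) p.68] -/
theorem exists_core_record (h : Cd.RefIsCore X C eX eC) :
    ∃ (E : FundamentalExtension.{0}) (iX : X.PiHat ≃ₜ* E.arith)
      (R : Literature.AnabelianGeometry.AbsoluteAnabelian.AbsTopII.EllipticCuspidalization E)
      (iC : C.PiHat ≃ₜ* R.core.arith),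
      ∀ x : X.PiTemp, R.toCore.arith (iX (X.toHat x)) = iC (C.toHat (Cd.refIncl X C eX eC x)) := by
  obtain ⟨E, iX, R, iC, -, hsq⟩ := h.core
  exact ⟨E, iX, R, iC, hsq⟩

end RefIsCore

/-- For the bundled genuine output, the reference inclusion is injective.
[claim: Mochizuki2012, status: disputed] (IUTchII §1 Prop 1.6 (i), kurims p.31) -/
theorem Genuine.inclRef_injective {X C : TemperedCurve p} {eX : X.PiTemp ≃ₜ* S.PiX} (G : CoreData.Genuine S P X C eX) :
    Function.Injective G.inclRef :=
  G.refIsCore.inclRef_injective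

end CoreData

end Literature.IUT.HodgeArakelov
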